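import Literature.MathematicalPhysics.QuantumFieldTheory.Balaban1983to89.TreeLengthDichotomy

/-!
# `Balaban1983to89.T4EpochSize` — LEMMA Y steps (2a) "within an event-free epoch" and (3) "epoch length" (record wording), their
GEOMETRIC INPUTS DISCHARGED ON THE CELL'S MODEL of the iterated operation `S`
(cell `pub-balaban`, rung (B)+1, node U5; record `t4/T4-EST-U5E-rem.md` v1.3 §4 (unit `b2b-balaban-pv25`); consumers
`…T4BankAgeYoung.lifetime_lt` (binders `hhalf`, `hint`, `hσ`) and `…T4SizeLedger.event_size_le` (binder `hold`);
journal CLAIM T4-U5.E-REM-EPOCHSIZE-K* 2026-08-19T03:23:53Z, unit `b2b-balaban-pv25` gen 6 — NEW leaf module,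
imports `…TreeLengthDichotomy` ONLY (unit pv14; → `…B16SProfile`, unit b02 gen 9) and modifies nothing;
`…T4BankAgeYoung` / `…T4SizeLedger` (this lineage, p182815 / p182963) are its consumers BY SHAPE and are deliberately
not imported)

HONEST FRAMING (cell `pub-balaban`, T4-DAG PAGE 1).  The cell's T4 target is the existence AND uniqueness of the
continuum limit of Bałaban's unit-scale averaged loop expectations on a finite torus — strictly beyond ultraviolet
stability ([Balaban1989LargeFieldII] Thm 1 p. 355); it is NOT the Yang–Mills mass gap and NOT the Clay problem.  This
module is REAL ARITHMETIC over kernel theorems of the sibling modules ONLY.  The MODEL: the index lattice `ℤᵈ` of unit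
cubes (`B13ScaleTransfer.Pt`), the linear size `TreeLength.treeLen`, the operation `S` and its iterates
`B16SProfile.Sop`, `B16SProfile.Siter (ratio L σ)` with scale ratios `L^{σ(i+1)+1−σ(i)}` under the two-sided drop control
`B16SProfile.DropCtl σ m` (b02's typed reading of [Balaban1989LargeFieldII] (2.5)/(2.9), pp. 384–385), the covers
`Z^{(i)} = closureIdx (Qprod (ratio L σ) i) Z`.  NOTHING of [Balaban1989LargeFieldII] is asserted here: the located
re-covering chain (α)/(β) of p. 384 and the definition of the last index `n₀` of p. 385 are quoted — render-read — in the
citation headers / docstrings of `…B16SProfile` and `…TreeLengthDichotomy`; page numbers below are LOCATIONS, there is no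
quotation (no guillemets), no `[cite:]` tag in this file, and phrases in double quotes are the RECORD's wording, not print.

WHAT THIS MODULE ADDS (all kernel-checked, `d` arbitrary).
* §1 STEP (2a) ON THE MODEL, uniform in the number of `S`-steps: for `L ≥ 4`, `DropCtl σ m`, a non-empty
  face-connected `Z` and every `i ≤ m`, `d(S^{i}(Z)) ≤ 10·126^d·(d(Z) + 1)` (`epochSize_le`) — from b02's
  `B16SProfile.profile_h1` (regime `d(Z^{(i)}) ≥ 1`: `≤ 10·126^d·2^{−i}·d(Z)`) and `profile_h2` (regime `d(Z^{(i)}) < 1`: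
  `≤ 5·126^d`) and pv14's dichotomy `TreeLengthDichotomy.treeLen_dichotomy`; `i = 0` is trivial.  This is the record's
  (2a) "d′_n(S^{n−s}(Z_s)) ≤ C_d·(σ_s + 1) for every n ≥ s" (record wording) with the MODEL constant
  `C = 10·126^d` (`modelC`, `one_le_modelC`) — i.e. the binder `hold : d(P i) ≤ C·(σ i + 1)` of
  `T4SizeLedger.event_size_le` for an old part `P i = S^{e−s}(Z_s)` within its drop-control horizon, and the "size of
  every domain ≤ C·Ψ" step of record (2c) (`epochSize_le_mul_potential`).
* §2 THE HALVING INPUT OF STEP (3) ON THE MODEL: the cover profile `t_k := d(Z^{(k)})` (extended by `0` beyond the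
  horizon `m`, `coverProfile`) satisfies `t_k ≤ 2^{−k}·d(Z)` for `k > 1` (`coverProfile_halving`, from
  `B16SProfile.two_pow_mul_treeLen_closureIdx_le`) and takes no value in `]0,1[` (`coverProfile_int`, from
  `TreeLengthDichotomy.treeLen_pos_iff`) — literally the binders `hhalf` / `hint` of `T4BankAgeYoung.lifetime_lt` and
  `hβ` / `hint` of `T4BankAgeYoung.lastPos_le_one_add_logb`.
* §3 STEP (3) WITH BOTH INPUTS DISCHARGED: if `d(Z) ≤ G`, `G ≥ 1`, then every index `k ≤ m` with `d(Z^{(k)}) > 0` (the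
  last index `n₀` with positive linear size of p. 385 — LOCATION; print's sentence is quoted render-read in
  `…TreeLengthDichotomy.exists_threshold_printed`'s docstring) satisfies `k ≤ 1 + log₂G`
  (`lastIndex_le_one_add_logb` — the arithmetic of `T4BankAgeYoung.lastPos_le_one_add_logb` over the two discharged
  shapes), and the threshold index of
  `TreeLengthDichotomy.exists_threshold_printed` obeys the same bound (`threshold_le_one_add_logb`).
* §4 NON-VACUITY: constant exponents satisfy the drop control (b02's `B16Absorption.dropCtl_const`; inlined here to keep
  the import to one module), so §1/§3 are inhabited (`epochSize_le_const`).

WHAT REMAINS A BINDER / A READING (named, not hidden).  The enlargement inequality (γ) of p. 385; the printed horizon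
bound `K ≤ n₀ − j + R_j` of p. 385 (LOCATION; the binder `hlen` of `lifetime_lt`; its model is b02's
`…B16StoppingRule` / `…B16MergeHorizon`, NOT touched here); the counting binders `hD`, `hV` and the bank inequality of
`lifetime_lt`; the identification of print's `d′_j` with `TreeLength.treeLen` and of print's `S`, `R_n = L^{σ_n}` with b02's `Sop` /
`Siter (ratio L σ)` / `DropCtl` (b02's standing model, `…B16SProfile` header); the re-covering constant of the MODEL is
`10·126^d` (b02's repaired constant), not print's `3(126)^d` / `(64)^d`.  Cell census: discharged binders on the MODEL,
NOT summit progress; NOT continuum, NOT Clay.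
-/

namespace Literature.MathematicalPhysics.QuantumFieldTheory.Balaban1983to89.T4EpochSize

open Literature.MathematicalPhysics.QuantumFieldTheory.Balaban1983to89
open Literature.MathematicalPhysics.QuantumFieldTheory.Balaban1983to89.B13ScaleTransfer
open Literature.MathematicalPhysics.QuantumFieldTheory.Balaban1983to89.TreeLength
open Literature.MathematicalPhysics.QuantumFieldTheory.Balaban1983to89.B16SProfile
open Literature.MathematicalPhysics.QuantumFieldTheory.Balaban1983to89.TreeLengthDichotomy

noncomputable section

variable {d : ℕ}

/-! ## §1 Step (2a) on the model: the size along an event-free epoch -/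

section EpochSize

/-- The re-covering constant OF THE MODEL (b02's repaired constant `10·126^d` of `B16SProfile.profile_h1`; print's
(α) has `3(126)^d`). [folklore] -/
def modelC (d : ℕ) : ℝ := 10 * 126 ^ d

/-- `modelC d = 10·126^d`. [folklore] -/
theorem modelC_eq (d : ℕ) : modelC d = 10 * 126 ^ d := rfl

/-- `1 ≤ 10·126^d` — the constant qualifies as the `C ≥ 1` of `T4BankAgeYoung.lifetime_lt` / `T4SizeLedger.potential_step`.
[folklore] -/
theorem one_le_modelC (d : ℕ) : 1 ≤ modelC d := by
  have h : (1 : ℝ) ≤ 126 ^ d := one_le_pow₀ (by norm_num)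
  unfold modelC
  linarith

/-- **STEP (2a) ON THE MODEL.**  For `L ≥ 4`, exponents under the drop control on `[0, m]`, a non-empty face-connected
`Z` and every `i ≤ m`: `d(S^{i}(Z)) ≤ 10·126^d·(d(Z) + 1)` — NO compounding along the epoch, because b02's profile
bounds compare `S^{i}(Z)` with the cover of the ORIGINAL `Z` (record §4 (2a)).  Cases: `i = 0` trivial; `d(Z^{(i)}) ≥ 1`
by `B16SProfile.profile_h1` (`2^{−i} ≤ 1`); `d(Z^{(i)}) = 0` by `B16SProfile.profile_h2`. [folklore] -/
theorem epochSize_le {L : ℕ} {σ : ℕ → ℕ} {m i : ℕ} (hL : 4 ≤ L) (h : DropCtl σ m) {Z : Finset (Pt d)}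
    (hZ : Z.Nonempty) (hZc : FaceConnected Z) (hi : i ≤ m) :
    treeLen (Siter (ratio L σ) i Z) ≤ 10 * 126 ^ d * (treeLen Z + 1) := by
  have h0 : 0 ≤ treeLen Z := treeLen_nonneg Z
  have hp : (0 : ℝ) ≤ 126 ^ d := by positivity
  have hp1 : (1 : ℝ) ≤ 126 ^ d := one_le_pow₀ (by norm_num)
  rcases Nat.eq_zero_or_pos i with rfl | hi1
  · rw [Siter_zero]
    nlinarith
  · rcases treeLen_dichotomy (closureIdx (Qprod (ratio L σ) i) Z) with ht0 | ht1
    · have h2 := profile_h2 (by omega) h hZ hZc hi ((treeLen_lt_one_iff _).2 ht0)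
      nlinarith
    · have h1 := profile_h1 hL h hZ hZc hi1 hi ht1
      have hhalf : (1 / 2 : ℝ) ^ i ≤ 1 := pow_le_one₀ (by norm_num) (by norm_num)
      have h3 : 10 * 126 ^ d * (1 / 2 : ℝ) ^ i * treeLen Z ≤ 10 * 126 ^ d * 1 * treeLen Z :=
        mul_le_mul_of_nonneg_right (mul_le_mul_of_nonneg_left hhalf (by positivity)) h0
      nlinarith

/-- The same with the named constant: `d(S^{i}(Z)) ≤ modelC d·(d(Z) + 1)` — the binder `hold` of
`T4SizeLedger.event_size_le` for an old part within its drop-control horizon. [folklore] -/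
theorem epochSize_le_modelC {L : ℕ} {σ : ℕ → ℕ} {m i : ℕ} (hL : 4 ≤ L) (h : DropCtl σ m) {Z : Finset (Pt d)}
    (hZ : Z.Nonempty) (hZc : FaceConnected Z) (hi : i ≤ m) :
    treeLen (Siter (ratio L σ) i Z) ≤ modelC d * (treeLen Z + 1) :=
  epochSize_le hL h hZ hZc hi

/-- "The size of every domain of h at every step is ≤ C·Ψ" (record §4 (2c), record wording): if the epoch base's term
`d(Z) + 1` is one of the summands of a potential value `Ψ` (so `d(Z) + 1 ≤ Ψ`), then `d(S^{i}(Z)) ≤ modelC d·Ψ` along the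
epoch — the shape of the binder `hσ` of `T4BankAgeYoung.lifetime_lt` one level down. [folklore] -/
theorem epochSize_le_mul_potential {L : ℕ} {σ : ℕ → ℕ} {m i : ℕ} (hL : 4 ≤ L) (h : DropCtl σ m)
    {Z : Finset (Pt d)} (hZ : Z.Nonempty) (hZc : FaceConnected Z) (hi : i ≤ m) {Ψ : ℝ} (hΨ : treeLen Z + 1 ≤ Ψ) :
    treeLen (Siter (ratio L σ) i Z) ≤ modelC d * Ψ := by
  have h1 := epochSize_le_modelC hL h hZ hZc hi
  have hC : 0 ≤ modelC d := le_trans zero_le_one (one_le_modelC d)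
  exact h1.trans (mul_le_mul_of_nonneg_left hΨ hC)

end EpochSize

/-! ## §2 The halving input of step (3) on the model -/

section Halving

/-- THE COVER PROFILE of an epoch with base `Z`: `t_k = d(Z^{(k)})` for `k ≤ m` (the drop-control horizon), extended by
`0` beyond it (the extension only serves the unbounded quantifier of `T4BankAgeYoung.lastPos_le_one_add_logb`).
[folklore] -/
def coverProfile (L : ℕ) (σ : ℕ → ℕ) (m : ℕ) (Z : Finset (Pt d)) (k : ℕ) : ℝ :=
  if k ≤ m then treeLen (closureIdx (Qprod (ratio L σ) k) Z) else 0

/-- Inside the horizon the profile is the cover's linear size. [folklore] -/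
theorem coverProfile_of_le {L : ℕ} {σ : ℕ → ℕ} {m k : ℕ} (Z : Finset (Pt d)) (hk : k ≤ m) :
    coverProfile L σ m Z k = treeLen (closureIdx (Qprod (ratio L σ) k) Z) := if_pos hk

/-- Beyond the horizon the profile is `0`. [folklore] -/
theorem coverProfile_of_gt {L : ℕ} {σ : ℕ → ℕ} {m k : ℕ} (Z : Finset (Pt d)) (hk : m < k) :
    coverProfile L σ m Z k = 0 := if_neg (not_le.mpr hk)

/-- At `k = 0` the profile is `d(Z)` itself (`Z^{(0)} = Z`). [folklore] -/
theorem coverProfile_zero (L : ℕ) (σ : ℕ → ℕ) (m : ℕ) (Z : Finset (Pt d)) :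
    coverProfile L σ m Z 0 = treeLen Z := by
  rw [coverProfile_of_le Z (Nat.zero_le m), Qprod_zero, closureIdx_one]

/-- **THE HALVING SHAPE (β) ON THE MODEL** — the binder `hhalf` of `T4BankAgeYoung.lifetime_lt` / `hβ` of
`lastPos_le_one_add_logb`: `t_k ≤ 2^{−k}·d(Z)` for every `k > 1` (`L ≥ 4`, drop control on `[0, m]`, `Z` non-empty
face-connected; inside the horizon by `B16SProfile.two_pow_mul_treeLen_closureIdx_le`, beyond it trivially). [folklore] -/
theorem coverProfile_halving {L : ℕ} {σ : ℕ → ℕ} {m : ℕ} (hL : 4 ≤ L) (h : DropCtl σ m) {Z : Finset (Pt d)}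
    (hZ : Z.Nonempty) (hZc : FaceConnected Z) :
    ∀ k, 1 < k → coverProfile L σ m Z k ≤ (1 / 2) ^ k * treeLen Z := by
  intro k hk
  have h0 : 0 ≤ treeLen Z := treeLen_nonneg Z
  by_cases hkm : k ≤ m
  · rw [coverProfile_of_le Z hkm]
    have h2 := two_pow_mul_treeLen_closureIdx_le hL h hZ hZc (by omega) hkm
    have hpos : (0 : ℝ) < 2 ^ k := by positivity
    have e : (1 / 2 : ℝ) ^ k * treeLen Z = treeLen Z / 2 ^ k := by
      rw [one_div, inv_pow, inv_mul_eq_div]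
    rw [e, le_div_iff₀ hpos, mul_comm]
    exact h2
  · rw [coverProfile_of_gt Z (not_le.mp hkm)]
    positivity

/-- **THE DICHOTOMY INPUT (I1) ON THE MODEL** — the binder `hint` of `lifetime_lt` / `lastPos_le_one_add_logb`: a
positive profile value is `≥ 1` (`TreeLengthDichotomy.treeLen_pos_iff`). [folklore] -/
theorem coverProfile_int {L : ℕ} {σ : ℕ → ℕ} {m : ℕ} (Z : Finset (Pt d)) :
    ∀ k, 0 < coverProfile L σ m Z k → 1 ≤ coverProfile L σ m Z k := by
  intro k hk
  by_cases hkm : k ≤ m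
  · rw [coverProfile_of_le Z hkm] at hk ⊢
    exact (treeLen_pos_iff _).mp hk
  · rw [coverProfile_of_gt Z (not_le.mp hkm)] at hk
    exact absurd hk (lt_irrefl 0)

end Halving

/-! ## §3 Step (3): the last positive index, with both inputs discharged -/

section LastIndex

/-- **STEP (3) ON THE MODEL.**  If the epoch base has `d(Z) ≤ G` with `G ≥ 1` (the size ceiling of the ledger,
`T4BankAgeYoung.ledger_le`), then every index `k ≤ m` at which the cover still has positive linear size —
`d(Z^{(k)}) > 0`, the printed regime condition of p. 385 (LOCATION) — satisfies `k ≤ 1 + log₂G`: the halving (β) and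
the dichotomy (I1) are supplied by §2; the arithmetic is that of `T4BankAgeYoung.lastPos_le_one_add_logb` (halving from
`k = 2` on and `t_k ≥ 1` force `2^k ≤ d(Z) ≤ G`). [folklore] -/
theorem lastIndex_le_one_add_logb {L : ℕ} {σ : ℕ → ℕ} {m : ℕ} (hL : 4 ≤ L) (h : DropCtl σ m) {Z : Finset (Pt d)}
    (hZ : Z.Nonempty) (hZc : FaceConnected Z) {G : ℝ} (hG : 1 ≤ G) (hZG : treeLen Z ≤ G) {k : ℕ} (hk : k ≤ m)
    (hpos : k = 0 ∨ 0 < treeLen (closureIdx (Qprod (ratio L σ) k) Z)) :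
    (k : ℝ) ≤ 1 + Real.logb 2 G := by
  have hlogG : 0 ≤ Real.logb 2 G := Real.logb_nonneg one_lt_two hG
  rcases Nat.lt_or_ge 1 k with hk1 | hk1
  swap
  · have : (k : ℝ) ≤ 1 := by exact_mod_cast hk1
    linarith
  · have hp : 0 < coverProfile L σ m Z k := by
      rcases hpos with h0 | h0
      · omega
      · rwa [coverProfile_of_le Z hk]
    have h1 : (1 : ℝ) ≤ (1 / 2) ^ k * treeLen Z :=
      le_trans (coverProfile_int Z k hp) (coverProfile_halving hL h hZ hZc k hk1)
    have h2p : (0 : ℝ) < 2 ^ k := by positivity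
    have hσ : (2 : ℝ) ^ k ≤ treeLen Z := by
      have e : (1 / 2 : ℝ) ^ k * treeLen Z = treeLen Z / 2 ^ k := by
        rw [div_pow, one_pow, div_mul_eq_mul_div, one_mul]
      rw [e, le_div_iff₀ h2p, one_mul] at h1
      exact h1
    have hGk : (2 : ℝ) ^ k ≤ G := hσ.trans hZG
    have hG0 : 0 < G := lt_of_lt_of_le h2p hGk
    have h3 : (k : ℝ) ≤ Real.logb 2 G := by
      rw [Real.le_logb_iff_rpow_le one_lt_two hG0, Real.rpow_natCast]
      exact hGk
    linarith

/-- The same for the THRESHOLD INDEX `i₀` of `TreeLengthDichotomy.exists_threshold_printed` (covers of positive size up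
to `i₀`, of size `0` after, on `[0, m]`): `i₀ ≤ 1 + log₂G`.  So an event-free epoch whose base obeys the size ceiling
has its last index with `d′ > 0` within `1 + log₂G` steps of its start — record §4 step (3), whose remaining input is
only the printed horizon bound `K ≤ n₀ − j + R_j` (p. 385, LOCATION; binder `hlen` of `lifetime_lt`). [folklore] -/
theorem threshold_le_one_add_logb {L : ℕ} {σ : ℕ → ℕ} (m : ℕ) (hL : 4 ≤ L) (h : DropCtl σ m) {Z : Finset (Pt d)}
    (hZ : Z.Nonempty) (hZc : FaceConnected Z) {G : ℝ} (hG : 1 ≤ G) (hZG : treeLen Z ≤ G) :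
    ∃ i₀, i₀ ≤ m ∧ (∀ i, 1 ≤ i → i ≤ i₀ → 0 < treeLen (closureIdx (Qprod (ratio L σ) i) Z)) ∧
      (∀ i, i₀ < i → i ≤ m → treeLen (closureIdx (Qprod (ratio L σ) i) Z) = 0) ∧
      ((i₀ : ℝ) ≤ 1 + Real.logb 2 G) := by
  obtain ⟨i₀, hi₀, hA, hB⟩ := exists_threshold_printed (by omega : 0 < L) σ m hZ hZc
  refine ⟨i₀, hi₀, hA, hB, lastIndex_le_one_add_logb hL h hZ hZc hG hZG hi₀ ?_⟩
  rcases Nat.eq_zero_or_pos i₀ with h0 | hp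
  · exact Or.inl h0
  · exact Or.inr (hA i₀ hp le_rfl)

/-- STEPS (2a) + (3) TOGETHER, in the ledger's terms: if the epoch base is dominated by the size ceiling
`G = C^A·(2·14^d + 6d)·A` of `T4BankAgeYoung.ledger_le` (any `G ≥ 1` with `d(Z) ≤ G`), then along the epoch every
domain has size `≤ 10·126^d·(G + 1)` AND the positive-size regime ends within `1 + log₂G` steps. [folklore] -/
theorem epoch_profile {L : ℕ} {σ : ℕ → ℕ} {m : ℕ} (hL : 4 ≤ L) (h : DropCtl σ m) {Z : Finset (Pt d)}
    (hZ : Z.Nonempty) (hZc : FaceConnected Z) {G : ℝ} (hG : 1 ≤ G) (hZG : treeLen Z ≤ G) :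
    (∀ i, i ≤ m → treeLen (Siter (ratio L σ) i Z) ≤ 10 * 126 ^ d * (G + 1)) ∧
      ∀ k, k ≤ m → 0 < treeLen (closureIdx (Qprod (ratio L σ) k) Z) → (k : ℝ) ≤ 1 + Real.logb 2 G := by
  refine ⟨fun i hi => ?_, fun k hk hpos => lastIndex_le_one_add_logb hL h hZ hZc hG hZG hk (Or.inr hpos)⟩
  have h1 := epochSize_le hL h hZ hZc hi
  have hp : (0 : ℝ) ≤ 10 * 126 ^ d := by positivity
  exact h1.trans (mul_le_mul_of_nonneg_left (by linarith) hp)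

end LastIndex

/-! ## §4 Non-vacuity -/

section NonVacuity

/-- §1 and §3 are inhabited: `d = 1`, `L = 4`, constant exponents, the one-cube base `Z = {0}` (`d(Z) = 0 ≤ G = 1`).
[folklore] -/
theorem epochSize_le_const (m i : ℕ) (hi : i ≤ m) :
    treeLen (Siter (ratio 4 (fun _ => (0 : ℕ))) i ({fun _ => (0 : ℤ)} : Finset (Pt 1))) ≤ 10 * 126 ^ 1 * (0 + 1) := by
  have hZ : ({fun _ => (0 : ℤ)} : Finset (Pt 1)).Nonempty := Finset.singleton_nonempty _
  have hZc : FaceConnected ({fun _ => (0 : ℤ)} : Finset (Pt 1)) := by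
    intro x hx y hy
    rw [Finset.mem_singleton] at hx hy
    subst hx; subst hy
    exact Relation.ReflTransGen.refl
  have h := epochSize_le (d := 1) (le_refl 4)
    (show DropCtl (fun _ => (0 : ℕ)) m from fun _ _ _ _ => Nat.le_add_right _ _) hZ hZc hi
  rwa [treeLen_singleton] at h

example (m : ℕ) : ∃ i₀, i₀ ≤ m ∧
    (∀ i, 1 ≤ i → i ≤ i₀ → 0 < treeLen (closureIdx (Qprod (ratio 4 (fun _ => (0 : ℕ))) i)
      ({fun _ => (0 : ℤ)} : Finset (Pt 1)))) ∧
    (∀ i, i₀ < i → i ≤ m → treeLen (closureIdx (Qprod (ratio 4 (fun _ => (0 : ℕ))) i)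
      ({fun _ => (0 : ℤ)} : Finset (Pt 1))) = 0) ∧ ((i₀ : ℝ) ≤ 1 + Real.logb 2 1) := by
  have hZ : ({fun _ => (0 : ℤ)} : Finset (Pt 1)).Nonempty := Finset.singleton_nonempty _
  have hZc : FaceConnected ({fun _ => (0 : ℤ)} : Finset (Pt 1)) := by
    intro x hx y hy
    rw [Finset.mem_singleton] at hx hy
    subst hx; subst hy
    exact Relation.ReflTransGen.refl
  exact threshold_le_one_add_logb (d := 1) m (le_refl 4)
    (show DropCtl (fun _ => (0 : ℕ)) m from fun _ _ _ _ => Nat.le_add_right _ _) hZ hZc le_rfl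
    (by rw [treeLen_singleton]; exact zero_le_one)

end NonVacuity

end

end Literature.MathematicalPhysics.QuantumFieldTheory.Balaban1983to89.T4EpochSize
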